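import Mathlib
import Summits.Ventures.PercRepro2.RootCutSupport

/-!
# The cut vertex at a root, III: the factorisation and the theorem (blind cell PercRepro2, p3 g0,
2026-08-25; `proofs/P3-BRIDGE.md` §8)

On the support of a `CutAtRoot` instance (`RootCutSupport.lean`) the kernel is the four-monomial
expansion `K₃ = Σⱼ lKⱼ(l-restriction) · hKcⱼ(h-restriction)` (`K3_eq_cut`), so
`typedCount F z τ K₃ = (S_same − S_cross) · T₁ · (inert count)` (`typedCount_eq_cutAtRoot`) with `T₁`
the `h`-side typed count of the coefficient `H1` at the pattern `(true, true, true)` — nonnegative by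
`sym_H1_ttt_nonneg` (`count_H1c_nonneg`), while the three cross coefficients pay `T₁` exactly
(`sym_sum_ttt_eq_zero`, `count_sumc_eq_zero`).  THEOREM `typedCount_nonneg_of_cutAtRoot`, and the
`z ≡ false` form `typedCount_nonneg_of_hasCutAtRoot` (`HasCutAtRoot`: the conjunct for the residual
domain).  Own work; standard axioms.
-/

namespace Summit.Ventures.PercRepro2

open UnionCluster

namespace CovForm

namespace RootBridge

open OneTyped TypedA3 Untouched TypedFactor Separated

/-! ## The kernel on the support, the factorisation and the theorem -/

section Main

open Classical

variable {V : Type*} {E : Type*} [Fintype E] [DecidableEq E] {R : Type*} [Field R]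
  [LinearOrder R] [IsStrictOrderedRing R]
variable (ends : E → Sym2 V) (o a₁ a₂ a₃ b : V)

/-- The typed edges within a side. -/
noncomputable def sideF (W : Set V) (F : Finset E) : Finset E := F.filter (· ∈ within ends W)

omit [Fintype E] [LinearOrder R] [IsStrictOrderedRing R] in
/-- The side restriction of the typed restriction to a side is the side restriction. -/
lemma withinRestr_restr_eq (W : Set V) {F : Finset E} {z x : Config E}
    (hx : ∀ e, e ∉ F → x e = z e) :
    withinRestr ends W (restr (sideF ends W F) z x) = withinRestr ends W x := by
  funext e
  unfold withinRestr
  split_ifs with hw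
  · by_cases heF : e ∈ F
    · rw [restr_of_mem (by simp [sideF, heF, hw])]
    · rw [restr_of_not_mem (by simp [sideF, heF]), hx e heF]
  · rfl

omit [Fintype E] [LinearOrder R] [IsStrictOrderedRing R] in
/-- The `h`-state only sees the `h`-side typed edges. -/
lemma hstC_restr (VH : Set V) {F : Finset E} {z x : Config E} (hx : ∀ e, e ∉ F → x e = z e) :
    hstC ends a₁ a₂ a₃ VH (restr (sideF ends VH F) z x) = hstC ends a₁ a₂ a₃ VH x := by
  unfold hstC
  rw [withinRestr_restr_eq ends VH hx]

/-- The `h`-kernel of a coefficient at a cut root. -/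
noncomputable def hKc (VH : Set V) (H : Bool → HState → Bool → HState → Bool → HState → ℤ) :
    Config E → Config E → Config E → R :=
  fun x y w => ((H true (hstC ends a₁ a₂ a₃ VH x) true (hstC ends a₁ a₂ a₃ VH y) true
    (hstC ends a₁ a₂ a₃ VH w) : ℤ) : R)

omit [Fintype E] [LinearOrder R] [IsStrictOrderedRing R] in
/-- A typed restriction of a copy of the support is below `z ∪ F`. -/
lemma restr_le_zF (A : Finset E) {F : Finset E} {z x : Config E}
    (hx : ∀ e, e ∉ F → x e = z e) : restr A z x ≤ zF F z := by
  intro e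
  by_cases heA : e ∈ A
  · rw [restr_of_mem heA]
    exact le_zF hx e
  · rw [restr_of_not_mem heA]
    by_cases heF : e ∈ F
    · simp [zF, heF]
    · simp [zF, heF]

omit [Fintype E] [LinearOrder R] [IsStrictOrderedRing R] in
/-- `1[v ∈ C(a₁)]` of the `l`-restriction is the `l`-side connection. -/
lemma iL_side {VL VH : Set V} {F : Finset E} {z : Config E}
    (h : CutAtRoot ends o a₁ a₂ a₃ b VL VH F z) {x : Config E} (hx : ∀ e, e ∉ F → x e = z e)
    (v : V) (hv : v ∈ VL) :
    iL ends a₁ v (restr (sideF ends VL F) z x) =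
      ((decide (Conn ends (withinRestr ends VL x) a₁ v) : Bool).toNat : R) := by
  have hsp := split_of_le ends o a₁ a₂ a₃ b h
    (restr_le_zF (sideF ends VL F) hx)
  have e := conn_side ends hsp h.cap h.a1L hv (x := restr (sideF ends VL F) z x)
  rw [withinRestr_restr_eq ends VL hx] at e
  rw [iL_eq_dec]
  by_cases hc : Conn ends (withinRestr ends VL x) a₁ v
  · have hc' := e.mpr hc
    simp [hc, hc']
  · have hc' : ¬ Conn ends (restr (sideF ends VL F) z x) a₁ v := fun h' => hc (e.mp h')
    simp [hc, hc']

omit [Fintype E] [LinearOrder R] [IsStrictOrderedRing R] in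
/-- **`K₃` on the support at a cut root** is the four-monomial expansion, each monomial an
`l`-kernel of the `l`-restriction times an `h`-kernel of the `h`-restriction. -/
theorem K3_eq_cut {VL VH : Set V} {F : Finset E} {z : Config E}
    (h : CutAtRoot ends o a₁ a₂ a₃ b VL VH F z) {x y w : Config E}
    (hx : ∀ e, e ∉ F → x e = z e) (hy : ∀ e, e ∉ F → y e = z e) (hw : ∀ e, e ∉ F → w e = z e) :
    (K3 ends o a₁ a₂ a₃ b x y w : R) =
      lK1 ends o a₁ b (restr (sideF ends VL F) z x) (restr (sideF ends VL F) z y)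
          (restr (sideF ends VL F) z w) *
        hKc ends a₁ a₂ a₃ VH H1 (restr (sideF ends VH F) z x) (restr (sideF ends VH F) z y)
          (restr (sideF ends VH F) z w) +
      lK2 ends o a₁ b (restr (sideF ends VL F) z x) (restr (sideF ends VL F) z y)
          (restr (sideF ends VL F) z w) *
        hKc ends a₁ a₂ a₃ VH H2 (restr (sideF ends VH F) z x) (restr (sideF ends VH F) z y)
          (restr (sideF ends VH F) z w) +
      lK3 ends o a₁ b (restr (sideF ends VL F) z x) (restr (sideF ends VL F) z y)
          (restr (sideF ends VL F) z w) *
        hKc ends a₁ a₂ a₃ VH H3 (restr (sideF ends VH F) z x) (restr (sideF ends VH F) z y)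
          (restr (sideF ends VH F) z w) +
      lK4 ends o a₁ b (restr (sideF ends VL F) z x) (restr (sideF ends VL F) z y)
          (restr (sideF ends VL F) z w) *
        hKc ends a₁ a₂ a₃ VH H4 (restr (sideF ends VH F) z x) (restr (sideF ends VH F) z y)
          (restr (sideF ends VH F) z w) := by
  rw [K3_eq_KB, st_eq_cutSt ends o a₁ a₂ a₃ b h hx, st_eq_cutSt ends o a₁ a₂ a₃ b h hy,
    st_eq_cutSt ends o a₁ a₂ a₃ b h hw, KB_cutSt]
  unfold expansion hKc lK1 lK2 lK3 lK4
  rw [hstC_restr ends a₁ a₂ a₃ VH hx, hstC_restr ends a₁ a₂ a₃ VH hy, hstC_restr ends a₁ a₂ a₃ VH hw]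
  push_cast
  simp only [iL_side ends o a₁ a₂ a₃ b h hx o h.oL,
    iL_side ends o a₁ a₂ a₃ b h hy o h.oL, iL_side ends o a₁ a₂ a₃ b h hy b h.bL,
    iL_side ends o a₁ a₂ a₃ b h hw o h.oL, iL_side ends o a₁ a₂ a₃ b h hw b h.bL]

/-- The `h`-count of `H1` at a cut root is nonnegative (`sym_H1_ttt_nonneg`). -/
theorem count_H1c_nonneg (VH : Set V) (B : Finset E) (z : Config E) (τ : E → ℕ)
    (hτ : ∀ e ∈ B, τ e = 1 ∨ τ e = 2) :
    0 ≤ typedCount B z τ (hKc ends a₁ a₂ a₃ VH H1 : Config E → Config E → Config E → R) := by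
  have h6 := six_mul_typedCount B z τ hτ (hKc ends a₁ a₂ a₃ VH H1 : Config E → Config E → Config E → R)
  have hpos : 0 ≤ typedCount B z τ (fun x y w => (hKc ends a₁ a₂ a₃ VH H1 x y w : R) +
      hKc ends a₁ a₂ a₃ VH H1 x w y + hKc ends a₁ a₂ a₃ VH H1 y x w + hKc ends a₁ a₂ a₃ VH H1 y w x +
      hKc ends a₁ a₂ a₃ VH H1 w x y + hKc ends a₁ a₂ a₃ VH H1 w y x) := by
    refine typedCount_nonneg_of_nonneg _ _ _ fun x y w => ?_
    have h0 := sym_H1_ttt_nonneg (hstC ends a₁ a₂ a₃ VH x) (hstC ends a₁ a₂ a₃ VH y)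
      (hstC ends a₁ a₂ a₃ VH w)
    unfold symH at h0
    unfold hKc
    exact_mod_cast h0
  have : (0 : R) ≤ 6 * typedCount B z τ (hKc ends a₁ a₂ a₃ VH H1 : Config E → Config E → Config E → R) := by
    rw [h6]; exact hpos
  linarith

/-- The four `h`-counts at a cut root sum to zero (`sym_sum_ttt_eq_zero`). -/
theorem count_sumc_eq_zero (VH : Set V) (B : Finset E) (z : Config E) (τ : E → ℕ)
    (hτ : ∀ e ∈ B, τ e = 1 ∨ τ e = 2) :
    typedCount B z τ (hKc ends a₁ a₂ a₃ VH H1 : Config E → Config E → Config E → R) +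
      typedCount B z τ (hKc ends a₁ a₂ a₃ VH H2) + typedCount B z τ (hKc ends a₁ a₂ a₃ VH H3) +
      typedCount B z τ (hKc ends a₁ a₂ a₃ VH H4) = 0 := by
  rw [← typedCount_add4]
  have h6 := six_mul_typedCount B z τ hτ (fun x y w => (hKc ends a₁ a₂ a₃ VH H1 x y w : R) +
    hKc ends a₁ a₂ a₃ VH H2 x y w + hKc ends a₁ a₂ a₃ VH H3 x y w + hKc ends a₁ a₂ a₃ VH H4 x y w)
  have hzero : typedCount B z τ (fun x y w =>
      ((hKc ends a₁ a₂ a₃ VH H1 x y w : R) + hKc ends a₁ a₂ a₃ VH H2 x y w +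
        hKc ends a₁ a₂ a₃ VH H3 x y w + hKc ends a₁ a₂ a₃ VH H4 x y w) +
      ((hKc ends a₁ a₂ a₃ VH H1 x w y : R) + hKc ends a₁ a₂ a₃ VH H2 x w y +
        hKc ends a₁ a₂ a₃ VH H3 x w y + hKc ends a₁ a₂ a₃ VH H4 x w y) +
      ((hKc ends a₁ a₂ a₃ VH H1 y x w : R) + hKc ends a₁ a₂ a₃ VH H2 y x w +
        hKc ends a₁ a₂ a₃ VH H3 y x w + hKc ends a₁ a₂ a₃ VH H4 y x w) +
      ((hKc ends a₁ a₂ a₃ VH H1 y w x : R) + hKc ends a₁ a₂ a₃ VH H2 y w x +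
        hKc ends a₁ a₂ a₃ VH H3 y w x + hKc ends a₁ a₂ a₃ VH H4 y w x) +
      ((hKc ends a₁ a₂ a₃ VH H1 w x y : R) + hKc ends a₁ a₂ a₃ VH H2 w x y +
        hKc ends a₁ a₂ a₃ VH H3 w x y + hKc ends a₁ a₂ a₃ VH H4 w x y) +
      ((hKc ends a₁ a₂ a₃ VH H1 w y x : R) + hKc ends a₁ a₂ a₃ VH H2 w y x +
        hKc ends a₁ a₂ a₃ VH H3 w y x + hKc ends a₁ a₂ a₃ VH H4 w y x)) =
      typedCount B z τ (fun _ _ _ => (0 : R)) := by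
    refine typedCount_congr' _ _ _ _ _ fun x y w => ?_
    have h0 := sym_sum_ttt_eq_zero (hstC ends a₁ a₂ a₃ VH x) (hstC ends a₁ a₂ a₃ VH y)
      (hstC ends a₁ a₂ a₃ VH w)
    unfold symH at h0
    unfold hKc
    have h0' := congrArg (fun n : ℤ => (n : R)) h0
    push_cast at h0' ⊢
    linear_combination h0'
  have : (6 : R) * typedCount B z τ (fun x y w => (hKc ends a₁ a₂ a₃ VH H1 x y w : R) +
      hKc ends a₁ a₂ a₃ VH H2 x y w + hKc ends a₁ a₂ a₃ VH H3 x y w + hKc ends a₁ a₂ a₃ VH H4 x y w) = 0 := by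
    rw [h6, hzero, typedCount_zero_kernel]
  exact (mul_eq_zero.1 this).resolve_left (by norm_num)

/-- **The cut-root identity**: `typedCount F z τ K₃ = (S_same − S_cross) · T₁ · (inert count)`. -/
theorem typedCount_eq_cutAtRoot {VL VH : Set V} (F : Finset E) (z : Config E) (τ : E → ℕ)
    (hτ : ∀ e ∈ F, τ e = 1 ∨ τ e = 2) (h : CutAtRoot ends o a₁ a₂ a₃ b VL VH F z) :
    typedCount F z τ (K3 ends o a₁ a₂ a₃ b : Config E → Config E → Config E → R) =
      (sSame (R := R) ends o a₁ b (sideF ends VL F) z τ -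
          sCross (R := R) ends o a₁ b (sideF ends VL F) z τ) *
        typedCount (sideF ends VH F) z τ
          (hKc ends a₁ a₂ a₃ VH H1 : Config E → Config E → Config E → R) *
        typedCount (F \ (sideF ends VL F ∪ sideF ends VH F)) z τ (fun _ _ _ => (1 : R)) := by
  set A := sideF ends VL F with hA
  set B := sideF ends VH F with hB
  set C := F \ (A ∪ B) with hC
  have hAF : A ⊆ F := Finset.filter_subset _ _
  have hBF : B ⊆ F := Finset.filter_subset _ _
  have hAB : Disjoint A B := by
    rw [Finset.disjoint_left]
    intro e heA heB
    simp only [hA, hB, sideF, Finset.mem_filter] at heA heB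
    exact h.noloop e heA.1 ⟨heA.2, heB.2⟩
  have hABF : A ∪ B ⊆ F := Finset.union_subset hAF hBF
  have hAC : Disjoint A C := Finset.disjoint_of_subset_left Finset.subset_union_left Finset.disjoint_sdiff
  have hBC : Disjoint B C := Finset.disjoint_of_subset_left Finset.subset_union_right Finset.disjoint_sdiff
  have hF : A ∪ B ∪ C = F := Finset.union_sdiff_of_subset hABF
  have hτA : ∀ e ∈ A, τ e = 1 ∨ τ e = 2 := fun e he => hτ e (hAF he)
  have hτB : ∀ e ∈ B, τ e = 1 ∨ τ e = 2 := fun e he => hτ e (hBF he)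
  have hker : typedCount F z τ (K3 ends o a₁ a₂ a₃ b : Config E → Config E → Config E → R) =
      typedCount F z τ (fun x y w =>
        lK1 ends o a₁ b (restr A z x) (restr A z y) (restr A z w) *
            hKc ends a₁ a₂ a₃ VH H1 (restr B z x) (restr B z y) (restr B z w) +
          lK2 ends o a₁ b (restr A z x) (restr A z y) (restr A z w) *
            hKc ends a₁ a₂ a₃ VH H2 (restr B z x) (restr B z y) (restr B z w) +
          lK3 ends o a₁ b (restr A z x) (restr A z y) (restr A z w) *
            hKc ends a₁ a₂ a₃ VH H3 (restr B z x) (restr B z y) (restr B z w) +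
          lK4 ends o a₁ b (restr A z x) (restr A z y) (restr A z w) *
            hKc ends a₁ a₂ a₃ VH H4 (restr B z x) (restr B z y) (restr B z w)) := by
    refine typedCount_congr_on_support F z τ fun x y w hc _ => ?_
    exact K3_eq_cut ends o a₁ a₂ a₃ b h (fun e he => (hc e he).1) (fun e he => (hc e he).2.1)
      (fun e he => (hc e he).2.2)
  rw [hker, typedCount_add4]
  have h1 := typedCount_mul_three A B C hAB hAC hBC z τ (lK1 ends o a₁ b)
    (hKc ends a₁ a₂ a₃ VH H1 : Config E → Config E → Config E → R)
  have h2 := typedCount_mul_three A B C hAB hAC hBC z τ (lK2 ends o a₁ b)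
    (hKc ends a₁ a₂ a₃ VH H2 : Config E → Config E → Config E → R)
  have h3' := typedCount_mul_three A B C hAB hAC hBC z τ (lK3 ends o a₁ b)
    (hKc ends a₁ a₂ a₃ VH H3 : Config E → Config E → Config E → R)
  have h4 := typedCount_mul_three A B C hAB hAC hBC z τ (lK4 ends o a₁ b)
    (hKc ends a₁ a₂ a₃ VH H4 : Config E → Config E → Config E → R)
  rw [hF] at h1 h2 h3' h4
  rw [h1, h2, h3', h4, count_lK1, count_lK2 ends o a₁ b A z τ hτA, count_lK3,
    count_lK4 ends o a₁ b A z τ hτA]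
  have hsum := count_sumc_eq_zero (R := R) ends a₁ a₂ a₃ VH B z τ hτB
  set S := sSame (R := R) ends o a₁ b A z τ with hS
  set X := sCross (R := R) ends o a₁ b A z τ with hX
  set T1 := typedCount B z τ (hKc ends a₁ a₂ a₃ VH H1 : Config E → Config E → Config E → R) with hT1
  set T2 := typedCount B z τ (hKc ends a₁ a₂ a₃ VH H2 : Config E → Config E → Config E → R) with hT2
  set T3 := typedCount B z τ (hKc ends a₁ a₂ a₃ VH H3 : Config E → Config E → Config E → R) with hT3
  set T4 := typedCount B z τ (hKc ends a₁ a₂ a₃ VH H4 : Config E → Config E → Config E → R) with hT4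
  set I := typedCount C z τ (fun _ _ _ => (1 : R)) with hI
  linear_combination (X * I) * hsum

/-- **Row 2′TRI when the root `a₁` is a cut vertex separating `{o, b}` from `{a₂, a₃}`**
(`P3-BRIDGE.md` §8), for every pinning and every type map with values in `{1, 2}`. -/
theorem typedCount_nonneg_of_cutAtRoot {VL VH : Set V} (F : Finset E) (z : Config E)
    (τ : E → ℕ) (hτ : ∀ e ∈ F, τ e = 1 ∨ τ e = 2) (h : CutAtRoot ends o a₁ a₂ a₃ b VL VH F z) :
    0 ≤ typedCount F z τ (K3 ends o a₁ a₂ a₃ b : Config E → Config E → Config E → R) := by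
  rw [typedCount_eq_cutAtRoot ends o a₁ a₂ a₃ b F z τ hτ h]
  have hS := sSame_sub_sCross_nonneg (R := R) ends o a₁ b (sideF ends VL F) z τ
    (fun e he => hτ e (Finset.filter_subset _ _ he))
  have hT := count_H1c_nonneg (R := R) ends a₁ a₂ a₃ VH (sideF ends VH F) z τ
    (fun e he => hτ e (Finset.filter_subset _ _ he))
  have hI : (0 : R) ≤ typedCount (F \ (sideF ends VL F ∪ sideF ends VH F)) z τ
      (fun _ _ _ => (1 : R)) :=
    typedCount_nonneg_of_nonneg _ _ _ fun _ _ _ => zero_le_one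
  exact mul_nonneg (mul_nonneg hS hT) hI

/-- **The cut-root class of the typed graph `(V, F)`**: `a₁` is a cut vertex of `(V, F)` separating
`{o, b}` from `{a₂, a₃}` (no hypothesis on the sides beyond the split). -/
def HasCutAtRoot (F : Finset E) : Prop :=
  ∃ VL VH : Set V, CutAtRoot ends o a₁ a₂ a₃ b VL VH F (fun _ => false)

/-- **Row 2′TRI on the cut-root class at `z ≡ false`** — a conjunct for the residual domain. -/
theorem typedCount_nonneg_of_hasCutAtRoot (F : Finset E) (τ : E → ℕ)
    (hτ : ∀ e ∈ F, τ e = 1 ∨ τ e = 2) (h : HasCutAtRoot ends o a₁ a₂ a₃ b F) :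
    0 ≤ typedCount F (fun _ => false) τ (K3 ends o a₁ a₂ a₃ b : Config E → Config E → Config E → R) := by
  obtain ⟨VL, VH, hc⟩ := h
  exact typedCount_nonneg_of_cutAtRoot ends o a₁ a₂ a₃ b F _ τ hτ hc

end Main

end RootBridge

end CovForm

end Summit.Ventures.PercRepro2
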